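import Mathlib
import HarnessLib.Audit

/-!
# Rung C1 of the crux `EulerZoomLiouville.PowerGaugeEulerLiouville`, NO-DRIFT lane (1/3): the zero set of a `C²`
# vector field near a zero of corank one lies on a `C²` curve

Route №10 `EulerZoomLiouville` (NavierStokesRegularity), crux E = stmt-NavierStokesRegularity-19832, tenure rung C1
(exactly self-similar members), registered residue `stub_selfSimilarExtremalRest`.  Lineage ns-typeII-p2 (gen 7).
GENERIC CALCULUS (no profile, no flow): inverse-function-theorem bookkeeping for the structure of the zero set `{W = 0}` of a `C²` map `W : E → E` (a real Hilbert space) near a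
zero `z₀` at which the derivative `L = DW(z₀)` has the unit vector `e` in its kernel and the «bordered» operator
`T = L + ⟪e, ·⟫ e` is invertible (equivalently: `ker L = ℝe` and `e ∉ range L` — the eigenvalue `0` of `L` is
SIMPLE).  Then (`exists_zeroCurve_of_corankOne`):

* the map `Ψ(y) = W(y) + ⟪e, y − z₀⟫ e` is a local `C²` diffeomorphism at `z₀` with `DΨ(z₀) = T`;
* `c(t) := Ψ⁻¹(t e)` is a `C²` curve through `c(0) = z₀` with `c'(0) = e`, along which `W(c(t)) ∈ ℝ e`
  (`W(c(t)) = (t − ⟪e, c(t) − z₀⟫) e`);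
* EVERY zero `y` of `W` in a ball `B(z₀, ρ)` lies on the curve: `y = c(⟪e, y − z₀⟫)` with `|⟪e, y − z₀⟫| < δ`.

So near a corank-one zero the zero set is a closed subset of an embedded `C²` arc (it may be the point `z₀` alone, a
Cantor set, or a full sub-arc).  Two supplements used by consumers: `exists_subarc_of_connected_subset_zeroSet` — a
CONNECTED set of zeros through `z₀` with a second point contains a non-trivial sub-arc `c([α, β])`, `α < β`, on one
side of `z₀` (connectedness against the tubular «slab» `{t₋ < ⟪e, y − z₀⟫ < t₊}`); and
`exists_bordered_equiv_near` — the bordered operators `⟪e, ·⟫(c'(t) − DW(c(t)) e) + DW(c(t))` stay invertible for small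
`t` (units are open), which is the non-degeneracy input of the drift chart at the arc points `c(t)`.

Use (files 2/3, 3/3 of the lane): the stagnation set `𝒩_W` of an in-window self-similar profile near a NON-ISOLATED
stagnation point `z₀` — there `0` is a simple eigenvalue of `DW(z₀)` (the others are `≥ 1+γ` and `≤ 2γ−1` at a bad
non-vortical node, `1+γ` and `2γ−1` at a vortical one) — lies on a `C²` arc; a backward trajectory whose cluster
set is a non-trivial continuum of nodes therefore clusters along a node ARC, along which a drift coordinate with
`|Df·W| ≤ K|W|²` exists (file 2/3), and the finite budget `∫‖W(Φ₋ₛx)‖² ds < ∞` forbids the infinitely many passages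
such clustering requires (file 3/3): every vortical backward trajectory converges to ONE node — the input that
ns-typeII-p3's `eq_zero_of_driftCoordinate_of_dominatedBlock_badNodes` takes as hypothesis (i).

WHAT THIS IS NOT: not NS, not E, not rung C1 — calculus on a real Hilbert space.  References: the inverse function
theorem, `C^r` case (Mathlib `ContDiffAt.toOpenPartialHomeomorph`). [folklore]
-/

noncomputable section

open Set Filter Metric Function
open scoped Topology RealInnerProductSpace

-- flat `Theorems/<Route><Decl>…` files of one crux share the namespace of the crux (tree convention)
set_option linter.dupNamespace false

namespace Summit.NavierStokesRegularity.NavierStokesRegularity.Theorems.PowerGaugeEulerLiouville.NoDrift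

variable {E : Type*} [NormedAddCommGroup E] [InnerProductSpace ℝ E]

/-- The bordering map `y ↦ ⟪e, y − z₀⟫ e` has derivative `⟪e, ·⟫ e` everywhere. [folklore] -/
theorem hasFDerivAt_inner_sub_smul (e z₀ y : E) :
    HasFDerivAt (fun y : E => (⟪e, y - z₀⟫ : ℝ) • e) ((innerSL ℝ e).smulRight e) y := by
  have h1 : HasFDerivAt (fun y : E => (⟪e, y - z₀⟫ : ℝ)) (innerSL ℝ e) y := by
    have h := (hasFDerivAt_const e y).inner ℝ ((hasFDerivAt_id y).sub_const z₀)
    refine h.congr_fderiv ?_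
    ext v
    simp [fderivInnerCLM_apply]
  exact h1.smul_const e

/-- The bordering map is smooth. [folklore] -/
theorem contDiff_inner_sub_smul (e z₀ : E) {n : WithTop ℕ∞} :
    ContDiff ℝ n (fun y : E => (⟪e, y - z₀⟫ : ℝ) • e) :=
  (contDiff_const.inner ℝ (contDiff_id.sub contDiff_const)).smul contDiff_const

variable [CompleteSpace E]

/-- **THE ZERO SET NEAR A CORANK-ONE ZERO LIES ON A `C²` CURVE.**  Let `W : E → E` be `C²` on a real Hilbert space,
`W(z₀) = 0`, `e` a unit vector with `DW(z₀) e = 0`, and suppose the bordered operator `T = DW(z₀) + ⟪e, ·⟫ e` is a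
linear homeomorphism.  Then there are `δ, ρ > 0` and a curve `c : ℝ → E`, `C²` on `(−δ, δ)`, with `c(0) = z₀`,
`c'(0) = e`, `W(c(t)) = (t − ⟪e, c(t) − z₀⟫) e` for `|t| < δ`, such that every zero `y ∈ B(z₀, ρ)` of `W` satisfies
`|⟪e, y − z₀⟫| < δ` and `y = c(⟪e, y − z₀⟫)`; moreover `c((−δ, δ)) ⊆ B(z₀, ρ')` can be read off continuity.
(Inverse function theorem for `Ψ(y) = W(y) + ⟪e, y − z₀⟫ e`, `c(t) = Ψ⁻¹(te)`.) [folklore] -/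
theorem exists_zeroCurve_of_corankOne {W : E → E} (hW : ContDiff ℝ 2 W) {z₀ e : E} (hz₀ : W z₀ = 0)
    (he : ‖e‖ = 1) (hLe : fderiv ℝ W z₀ e = 0) (T : E ≃L[ℝ] E)
    (hT : (T : E →L[ℝ] E) = fderiv ℝ W z₀ + (innerSL ℝ e).smulRight e) :
    ∃ δ : ℝ, 0 < δ ∧ ∃ ρ : ℝ, 0 < ρ ∧ ∃ c : ℝ → E,
      ContDiffOn ℝ 2 c (Ioo (-δ) δ) ∧ c 0 = z₀ ∧ HasDerivAt c e 0 ∧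
      (∀ t ∈ Ioo (-δ) δ, W (c t) = (t - ⟪e, c t - z₀⟫) • e) ∧
      (∀ t ∈ Ioo (-δ) δ, ⟪e, W (c t)⟫ + ⟪e, c t - z₀⟫ = t) ∧
      (∀ y ∈ ball z₀ ρ, W y = 0 → ⟪e, y - z₀⟫ ∈ Ioo (-δ) δ ∧ c ⟪e, y - z₀⟫ = y) := by
  -- the chart `Ψ`
  set Ψ : E → E := fun y => W y + (⟪e, y - z₀⟫ : ℝ) • e with hΨdef
  have hΨ : ContDiff ℝ 2 Ψ := hW.add (contDiff_inner_sub_smul e z₀)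
  have hΨ' : HasFDerivAt Ψ (T : E →L[ℝ] E) z₀ := by
    rw [hT]
    exact ((hW.differentiable (by norm_num)) z₀).hasFDerivAt.add (hasFDerivAt_inner_sub_smul e z₀ z₀)
  have hΨz₀ : Ψ z₀ = 0 := by simp [hΨdef, hz₀]
  have h2 : (2 : WithTop ℕ∞) ≠ 0 := by norm_num
  set H := hΨ.contDiffAt.toOpenPartialHomeomorph Ψ hΨ' h2 with hHdef
  have hHcoe : (H : E → E) = Ψ := ContDiffAt.toOpenPartialHomeomorph_coe hΨ.contDiffAt hΨ' h2
  have hz₀s : z₀ ∈ H.source := ContDiffAt.mem_toOpenPartialHomeomorph_source hΨ.contDiffAt hΨ' h2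
  have h0t : (0 : E) ∈ H.target := by
    have h := ContDiffAt.image_mem_toOpenPartialHomeomorph_target hΨ.contDiffAt hΨ' h2
    rwa [hΨz₀] at h
  have hsymm0 : H.symm 0 = z₀ := by
    have h := H.left_inv hz₀s
    rwa [hHcoe, hΨz₀] at h
  -- `H.symm` is `C²` near `0` and has derivative `T⁻¹` at `0`
  have hsymmC : ContDiffAt ℝ 2 H.symm 0 := by
    refine H.contDiffAt_symm (f₀' := T) h0t ?_ ?_
    · rw [hsymm0, hHcoe]; exact hΨ'
    · rw [hsymm0, hHcoe]; exact hΨ.contDiffAt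
  have hsymmD : HasFDerivAt H.symm (T.symm : E →L[ℝ] E) 0 := by
    refine H.hasFDerivAt_symm h0t ?_
    rw [hsymm0, hHcoe]; exact hΨ'
  obtain ⟨u, hu, hCu⟩ : ∃ u ∈ 𝓝 (0 : E), ContDiffOn ℝ 2 H.symm u := by
    obtain ⟨u, hu, -, hCu⟩ := hsymmC.contDiffWithinAt.contDiffOn (m := 2) le_rfl (by simp)
    rw [insert_eq_of_mem (mem_univ _), nhdsWithin_univ] at hu
    exact ⟨u, hu, hCu⟩
  obtain ⟨δ, hδ, hδu⟩ : ∃ δ : ℝ, 0 < δ ∧ ball (0 : E) δ ⊆ u ∩ H.target := by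
    have h : u ∩ H.target ∈ 𝓝 (0 : E) := inter_mem hu (H.open_target.mem_nhds h0t)
    obtain ⟨δ, hδ, hsub⟩ := Metric.mem_nhds_iff.1 h
    exact ⟨δ, hδ, hsub⟩
  obtain ⟨ρ₁, hρ₁, hρ₁s⟩ : ∃ ρ₁ : ℝ, 0 < ρ₁ ∧ ball z₀ ρ₁ ⊆ H.source :=
    Metric.mem_nhds_iff.1 (H.open_source.mem_nhds hz₀s)
  -- the curve
  set c : ℝ → E := fun t => H.symm (t • e) with hcdef
  have hte : ∀ t : ℝ, t ∈ Ioo (-δ) δ → t • e ∈ ball (0 : E) δ := by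
    intro t ht
    rw [mem_ball, dist_zero_right, norm_smul, he, mul_one, Real.norm_eq_abs, abs_lt]
    exact ht
  have hWc : ∀ t ∈ Ioo (-δ) δ, W (c t) = (t - ⟪e, c t - z₀⟫) • e := by
    intro t ht
    have htt : t • e ∈ H.target := (hδu (hte t ht)).2
    have h := H.right_inv htt
    rw [hHcoe] at h
    -- `Ψ (c t) = t • e`
    have h' : W (c t) + (⟪e, c t - z₀⟫ : ℝ) • e = t • e := h
    rw [sub_smul]
    exact eq_sub_of_add_eq h'
  refine ⟨δ, hδ, min ρ₁ δ, lt_min hρ₁ hδ, c, ?_, ?_, ?_, hWc, ?_, ?_⟩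
  · -- `C²` on `(−δ, δ)`
    have hlin : ContDiff ℝ 2 (fun t : ℝ => t • e) := contDiff_id.smul contDiff_const
    refine (hCu.comp hlin.contDiffOn ?_)
    intro t ht
    exact (hδu (hte t ht)).1
  · -- `c 0 = z₀`
    simp [hcdef, hsymm0]
  · -- `c'(0) = e`
    have h1 : HasDerivAt (fun t : ℝ => t • e) e 0 := by
      simpa using (hasDerivAt_id (0 : ℝ)).smul_const e
    have h2' : HasFDerivAt H.symm (T.symm : E →L[ℝ] E) ((fun t : ℝ => t • e) 0) := by simpa using hsymmD
    have h3 := h2'.comp_hasDerivAt (0 : ℝ) h1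
    have hTe : T e = e := by
      have : (T : E →L[ℝ] E) e = e := by
        rw [hT]
        simp [hLe, he]
      exact this
    have hTse : T.symm e = e := by
      rw [ContinuousLinearEquiv.symm_apply_eq]; exact hTe.symm
    have h4 : (T.symm : E →L[ℝ] E) e = e := hTse
    simpa [hcdef, Function.comp_def, h4] using h3
  · -- the parameter is recovered by `⟪e, Ψ(·)⟫`
    intro t ht
    rw [hWc t ht, inner_smul_right, real_inner_self_eq_norm_sq, he]
    ring
  · -- zeros in `B(z₀, ρ)` lie on the curve
    intro y hy hWy
    have hys : y ∈ H.source := hρ₁s (ball_subset_ball (min_le_left _ _) hy)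
    have hin : |(⟪e, y - z₀⟫ : ℝ)| < δ := by
      have h1 : |(⟪e, y - z₀⟫ : ℝ)| ≤ ‖e‖ * ‖y - z₀‖ := abs_real_inner_le_norm e (y - z₀)
      rw [he, one_mul] at h1
      have h2 : ‖y - z₀‖ < δ := by
        have := ball_subset_ball (min_le_right ρ₁ δ) hy
        rwa [mem_ball, dist_eq_norm] at this
      exact lt_of_le_of_lt h1 h2
    refine ⟨abs_lt.1 hin, ?_⟩
    have hΨy : Ψ y = (⟪e, y - z₀⟫ : ℝ) • e := by simp [hΨdef, hWy]
    have h := H.left_inv hys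
    rw [hHcoe, hΨy] at h
    exact h


/-! ### Supplement 1: a connected set of zeros through `z₀` contains a sub-arc -/

omit [CompleteSpace E] in
/-- **A CONNECTED SET OF ZEROS THROUGH A CORANK-ONE ZERO CONTAINS A SUB-ARC.**  In the situation of
`exists_zeroCurve_of_corankOne` (only its conclusions are assumed: `c(0) = z₀`, `c` continuous at `0`, and every
zero in `B(z₀, ρ)` is `c(⟪e, y − z₀⟫)` with `|⟪e, y − z₀⟫| < δ`), let `Z` be a preconnected set of zeros of `W`
containing `z₀` and some other point.  Then for every `ε > 0` there is a non-trivial parameter interval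
`[α, β] ⊆ (−ε, ε)`, `α < β`, with `c([α, β]) ⊆ Z` (on one side of `z₀`).  Proof: if parameters `t₋ < 0 < t₊`
with `c(t±) ∉ Z` existed arbitrarily close to `0`, the open slab `{‖y − z₀‖ < ρ/2, t₋ < ⟪e, y − z₀⟫ < t₊}` would
contain `z₀` and have no point of `Z` on its frontier, so it would contain the preconnected `Z` — for slabs
thinner than `|⟪e, z₁ − z₀⟫|` this loses the second point `z₁`. [folklore] -/
theorem exists_subarc_of_isPreconnected_subset_zeroSet {W : E → E} {z₀ e : E} {δ ρ : ℝ} (hρ : 0 < ρ)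
    {c : ℝ → E} (hc0 : c 0 = z₀) (hcont : ContinuousAt c 0)
    (hzero : ∀ y ∈ ball z₀ ρ, W y = 0 → ⟪e, y - z₀⟫ ∈ Ioo (-δ) δ ∧ c ⟪e, y - z₀⟫ = y)
    {Z : Set E} (hZ : IsPreconnected Z) (hZW : ∀ z ∈ Z, W z = 0) (hz₀ : z₀ ∈ Z) {z₁ : E} (hz₁ : z₁ ∈ Z)
    (hne : z₁ ≠ z₀) {ε : ℝ} (hε : 0 < ε) :
    ∃ α β : ℝ, α < β ∧ Icc α β ⊆ Ioo (-ε) ε ∧ ∀ t ∈ Icc α β, c t ∈ Z := by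
  -- the parameter map
  set P : E → ℝ := fun y => ⟪e, y - z₀⟫ with hP
  have hPc : Continuous P := continuous_const.inner (continuous_id.sub continuous_const)
  -- `ε₁`: parameters below `ε₁` give points of the curve in `B(z₀, ρ/2)`
  obtain ⟨ε₁, hε₁, hε₁ε, hε₁c⟩ : ∃ ε₁ : ℝ, 0 < ε₁ ∧ ε₁ ≤ ε ∧ ∀ t : ℝ, |t| < ε₁ → ‖c t - z₀‖ < ρ / 2 := by
    have h : ∀ᶠ t in 𝓝 (0 : ℝ), ‖c t - z₀‖ < ρ / 2 := by
      have h1 : Tendsto (fun t => ‖c t - z₀‖) (𝓝 0) (𝓝 ‖c 0 - z₀‖) :=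
        ((hcont.sub continuousAt_const).norm).tendsto
      rw [hc0, sub_self, norm_zero] at h1
      exact h1.eventually (gt_mem_nhds (by positivity))
    obtain ⟨ε₂, hε₂, hball⟩ := Metric.eventually_nhds_iff.1 h
    refine ⟨min ε₂ ε, lt_min hε₂ hε, min_le_right _ _, fun t ht => hball ?_⟩
    rw [dist_zero_right, Real.norm_eq_abs]
    exact lt_of_lt_of_le ht (min_le_left _ _)
  -- the threshold `t*`
  obtain ⟨tstar, htstar, htstarε₁, hlost⟩ : ∃ tstar : ℝ, 0 < tstar ∧ tstar ≤ ε₁ ∧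
      ∀ tp tm : ℝ, tm < 0 → 0 < tp → tp < tstar → -tstar < tm →
        ¬ (‖z₁ - z₀‖ < ρ / 2 ∧ tm < P z₁ ∧ P z₁ < tp) := by
    by_cases h1 : ‖z₁ - z₀‖ < ρ / 2
    · -- `z₁` is a zero in the ball: `z₁ = c (P z₁)` with `P z₁ ≠ 0`
      have hz₁b : z₁ ∈ ball z₀ ρ := by
        rw [mem_ball, dist_eq_norm]; linarith
      have hPz₁ : P z₁ ≠ 0 := by
        intro h0
        have h := (hzero z₁ hz₁b (hZW z₁ hz₁)).2
        rw [show (⟪e, z₁ - z₀⟫ : ℝ) = P z₁ from rfl, h0, hc0] at h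
        exact hne h.symm
      refine ⟨min ε₁ |P z₁|, lt_min hε₁ (abs_pos.2 hPz₁), min_le_left _ _, ?_⟩
      rintro tp tm htm htp htp' htm' ⟨-, h2, h3⟩
      have h4 : |P z₁| < min ε₁ |P z₁| := by
        rw [abs_lt]; constructor <;> linarith
      exact absurd (lt_of_lt_of_le h4 (min_le_right _ _)) (lt_irrefl _)
    · exact ⟨ε₁, hε₁, le_rfl, fun tp tm _ _ _ _ h => h1 h.1⟩
  -- the slab argument: parameters `tm < 0 < tp` near `0` off `Z` force `Z` into the slab
  have hslab : ∀ tp tm : ℝ, tm < 0 → 0 < tp → tp < tstar → -tstar < tm → c tp ∉ Z → c tm ∉ Z → False := by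
    intro tp tm htm htp htp' htm' hcp hcm
    set G : Set E := {y | ‖y - z₀‖ < ρ / 2 ∧ tm < P y ∧ P y < tp} with hG
    have hGo : IsOpen G := by
      refine (isOpen_lt (continuous_id.sub continuous_const).norm continuous_const).inter ?_
      exact (isOpen_lt continuous_const hPc).inter (isOpen_lt hPc continuous_const)
    -- every point of `Z` in the closure of `G` lies in `G`
    have hkey : ∀ z ∈ Z, ‖z - z₀‖ ≤ ρ / 2 → tm ≤ P z → P z ≤ tp → z ∈ G := by
      intro z hz h1 h2 h3
      have hzb : z ∈ ball z₀ ρ := by rw [mem_ball, dist_eq_norm]; linarith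
      obtain ⟨-, hcz⟩ := hzero z hzb (hZW z hz)
      change c (P z) = z at hcz
      have h2' : tm < P z := by
        rcases eq_or_lt_of_le h2 with h | h
        · exact absurd (by rw [h, hcz]; exact hz) hcm
        · exact h
      have h3' : P z < tp := by
        rcases eq_or_lt_of_le h3 with h | h
        · exact absurd (by rw [← h, hcz]; exact hz) hcp
        · exact h
      have hPz : |P z| < ε₁ := by
        rw [abs_lt]; constructor <;> linarith
      have h4 := hε₁c (P z) hPz
      rw [hcz] at h4
      exact ⟨h4, h2', h3'⟩
    -- `Z ⊆ G ∪ (closure G)ᶜ`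
    have hsub : Z ⊆ G ∪ (closure G)ᶜ := by
      intro z hz
      by_cases hzc : z ∈ closure G
      · left
        -- closure of `G` is contained in the non-strict slab
        have hcl : closure G ⊆ {y | ‖y - z₀‖ ≤ ρ / 2 ∧ tm ≤ P y ∧ P y ≤ tp} := by
          refine closure_minimal (fun y hy => ⟨hy.1.le, hy.2.1.le, hy.2.2.le⟩) ?_
          refine (isClosed_le (continuous_id.sub continuous_const).norm continuous_const).inter ?_
          exact (isClosed_le continuous_const hPc).inter (isClosed_le hPc continuous_const)
        obtain ⟨h1, h2, h3⟩ := hcl hzc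
        exact hkey z hz h1 h2 h3
      · right; exact hzc
    have hz₀G : z₀ ∈ G := by
      refine ⟨by simp [hρ], ?_, ?_⟩ <;> simp [hP, htm, htp]
    have hZG : Z ⊆ G := hZ.subset_left_of_subset_union hGo isClosed_closure.isOpen_compl
      (disjoint_compl_right.mono_right (compl_subset_compl.2 subset_closure)) hsub ⟨z₀, hz₀, hz₀G⟩
    have h := hZG hz₁
    exact hlost tp tm htm htp htp' htm' ⟨h.1, h.2.1, h.2.2⟩
  -- hence one side of `z₀` is entirely in `Z` below `t*`
  have hside : (∀ t : ℝ, 0 < t → t < tstar → c t ∈ Z) ∨ (∀ t : ℝ, -tstar < t → t < 0 → c t ∈ Z) := by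
    by_contra h
    rw [not_or] at h
    obtain ⟨h1, h2⟩ := h
    push Not at h1 h2
    obtain ⟨tp, htp, htp', hcp⟩ := h1
    obtain ⟨tm, htm', htm, hcm⟩ := h2
    exact hslab tp tm htm htp htp' htm' hcp hcm
  rcases hside with h | h
  · refine ⟨tstar / 4, tstar / 2, by linarith, fun t ht => ⟨?_, ?_⟩, fun t ht => h t ?_ ?_⟩
    · linarith [ht.1]
    · linarith [ht.2]
    · linarith [ht.1]
    · linarith [ht.2]
  · refine ⟨-(tstar / 2), -(tstar / 4), by linarith, fun t ht => ⟨?_, ?_⟩, fun t ht => h t ?_ ?_⟩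
    · linarith [ht.1]
    · linarith [ht.2]
    · linarith [ht.1]
    · linarith [ht.2]

/-! ### Supplement 2: the bordered operators along the curve stay invertible -/

/-- Units of `E →L[ℝ] E` near a unit: if `t ↦ A t` is continuous at `t₀` (within `s`) and `A t₀` is a linear
homeomorphism, then `A t` is one for `t ∈ s` near `t₀`. [folklore] -/
theorem eventually_exists_equiv_of_continuousWithinAt {A : ℝ → E →L[ℝ] E} {s : Set ℝ} {t₀ : ℝ}
    (hA : ContinuousWithinAt A s t₀) (T : E ≃L[ℝ] E) (hT : (T : E →L[ℝ] E) = A t₀) :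
    ∀ᶠ t in 𝓝[s] t₀, ∃ Tt : E ≃L[ℝ] E, (Tt : E →L[ℝ] E) = A t := by
  have hunit : IsUnit (A t₀) := by
    rw [← hT]; exact ⟨ContinuousLinearEquiv.toUnit T, rfl⟩
  have hopen : IsOpen {x : E →L[ℝ] E | IsUnit x} := Units.isOpen
  have h := hA.preimage_mem_nhdsWithin (hopen.mem_nhds hunit)
  filter_upwards [h] with t ht
  obtain ⟨u, hu⟩ := (ht : IsUnit (A t))
  exact ⟨ContinuousLinearEquiv.unitsEquiv ℝ E u, by rw [← hu]; rfl⟩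

/-- **THE BORDERED OPERATORS ALONG THE CURVE STAY INVERTIBLE.**  If `c` is `C¹` on the open interval `I ∋ t₀`
(so `c'` is continuous there), `W` is `C²`, and the bordered operator `⟪e, ·⟫ (c'(t₀) − DW(c t₀) e) + DW(c t₀)`
is a linear homeomorphism, then so is `⟪e, ·⟫ (c'(t) − DW(c t) e) + DW(c t)` for all `t ∈ I` near `t₀`.
(With `exists_zeroCurve_of_corankOne`: at `t₀ = 0`, `c'(0) = e` and `DW(z₀) e = 0`, so the operator there is
the original `T`.) [folklore] -/
theorem eventually_exists_borderedEquiv {W : E → E} (hW : ContDiff ℝ 2 W) {c : ℝ → E} {I : Set ℝ}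
    (hI : IsOpen I) {t₀ : ℝ} (ht₀ : t₀ ∈ I) (hc : ContDiffOn ℝ 1 c I) (e : E) (T : E ≃L[ℝ] E)
    (hT : (T : E →L[ℝ] E) =
      (innerSL ℝ e).smulRight (deriv c t₀ - fderiv ℝ W (c t₀) e) + fderiv ℝ W (c t₀)) :
    ∀ᶠ t in 𝓝 t₀, ∃ Tt : E ≃L[ℝ] E,
      (Tt : E →L[ℝ] E) = (innerSL ℝ e).smulRight (deriv c t - fderiv ℝ W (c t) e) + fderiv ℝ W (c t) := by
  set A : ℝ → E →L[ℝ] E := fun t =>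
    (innerSL ℝ e).smulRight (deriv c t - fderiv ℝ W (c t) e) + fderiv ℝ W (c t) with hAdef
  have hcc : ContinuousOn c I := hc.continuousOn
  have hdc : ContinuousOn (deriv c) I := hc.continuousOn_deriv_of_isOpen hI le_rfl
  have hDW : Continuous (fderiv ℝ W) := hW.continuous_fderiv (by norm_num)
  have hL : ContinuousOn (fun t => fderiv ℝ W (c t)) I := hDW.comp_continuousOn hcc
  have hA : ContinuousOn A I := by
    have h1 : ContinuousOn (fun t => deriv c t - fderiv ℝ W (c t) e) I :=
      hdc.sub (hL.clm_apply continuousOn_const)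
    have h2 : ContinuousOn (fun t => (innerSL ℝ e).smulRight (deriv c t - fderiv ℝ W (c t) e)) I :=
      ((ContinuousLinearMap.smulRightL ℝ E E (innerSL ℝ e)).continuous).comp_continuousOn h1
    exact h2.add hL
  have h := eventually_exists_equiv_of_continuousWithinAt (hA t₀ ht₀) T hT
  rw [hI.nhdsWithin_eq ht₀] at h
  exact h

end Summit.NavierStokesRegularity.NavierStokesRegularity.Theorems.PowerGaugeEulerLiouville.NoDrift

end
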